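import Summits.QuantumFields.YangMills.Theorems.BalabanUVNodesN16Thm4ZdOfLeaf
import HarnessLib

/-!
# Route «BalabanUVNodes» (K3 `SpineGivenEndpointR11`), DAG node N16 = NE3 — POINTWISE READ-OUTS of [B8]'s weighted suprema `|·|₍₋ₙ₎`
# (`B8ScaledSupNorm.msup ∕ bondNorm`) and of the [B9] (3.40) Hölder supremum AT THE ALL-TORUS MEMBER (`Ω_j = ℤᵈ`): (1.36)₂, (1.36)₃, (1.39)₂
# at every bond ∕ nearest-neighbour pair, from a bounded Lie-algebra field

Cell `pub-ymgap`, seat `pub-ymgap-dag-n16-c` (R134 fan-out seat, strategy s1; HUMAN RULING D-0062; chair R424 venue), generation 0, file 4a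
(serves file 4b `…N16Thm4ZdPrintOfLeaf`); `--supports stmt-QuantumFields-19676`; `bears_on: R4∕N16 · edge N05 → N16`.

WHY.  N05's leaf states Proposition 3's conclusions (1.36)₂ `|∇^η_{U₀}A|₍₋₂₎ ≤ B₁s`, (1.36)₃ (Hölder, `≤ B₂s`) and (1.39) `|Δ^η_{U₀}A|₍₋₃₎ ≤ B₁s`
through the multi-level weighted suprema of `B8ScaledSupNorm` — real `iSup`s, which are genuine suprema only for BOUNDED families.  N16 reads
them POINTWISE at the top level `k` (`Lᵏη = 1` in its letters).  This file provides the crude a-priori bounds that make the families bounded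
once `|A|` is ((1.62)), and the pointwise read-outs at the all-torus member, where every bond touches `Ω_k = ℤᵈ`.

WHAT THIS FILE PROVES (kernel, theorems only, 0 `def`, 0 sorry): `bdd_of_norm_le` (bounded family ⟹ `Bdd` for exponents `α ≤ 0`),
`norm_covDerivFwd_le_of_bound` (`‖D^η_{U₀,μ}f‖ ≤ η⁻¹·2a`), `norm_covLap_le_of_bound` (`‖Δ^η_{U₀}f‖ ≤ d·η⁻¹·2·η⁻¹·2a`),
**`grad_pointwise_of_msup`** (`‖(D^η_{U₀,μ}A_κ)(x)‖ ≤ c·(Lᵏη)^{−2}`), **`lap_pointwise_of_bondNorm`** (`‖(Δ^η_{U₀}A_κ)(x)‖ ≤ c·(Lᵏη)^{−3}`),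
**`holder_pointwise_of_msup`** (`‖R(U₀(y,μ))(D^η_{U₀,μ}A_κ)(y+e_μ) − (D^η_{U₀,μ}A_κ)(y)‖ ≤ c·(Lᵏη)^{−(2+β)}·(η·len e_μ)^β` at admissible pairs,
`β ≥ 0`, `len ≥ 1` on its support).
HONEST FRAMING: elementary bookkeeping on the tree's norms; nothing of Bałaban's is proved; N16 ∕ NE3 NOT discharged; count-neutral; NOT ℝ⁴,
NOT infinite volume, NOT OS, NOT a mass gap, NOT Clay.
-/

set_option autoImplicit false

open scoped BigOperators
open NormedSpace

namespace Summit.QuantumFields.YangMills.BalabanUVNodes.N16.Thm4ZdPrintReadouts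

open Literature.MathematicalPhysics.QuantumFieldTheory.Balaban1983to89
open B7Prop1Explicit B7Prop2Explicit
open B7Eq78Linearization (conjR)
open B8Ineq132 (BondTouches covDerivFwd covDeriv norm_conjR_le)
open B8Eq138LandauZd (covLap covDivB)
open B8Eq140Level (SideTouches)
open B8Eq143PlaqExpansion (norm_covDeriv_le)
open B8Eq155JBound (gradNorm2 gradNorm2_nonneg)
open B8ScaledSupNorm (msup bondNorm weight Bdd bdd_of_forall norm_le_of_msup_le scale_pos)
open B9Eq340HolderZd (hquot AdmPair trans trans_step hquot_le_of_141)
open Thm4ZdOfLeaf (sideTouches_univ)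

noncomputable section

variable {d : ℕ}

/-! ## §1 Crude bounds and pointwise read-outs of the weighted suprema at the all-torus member -/

section Readouts

variable {𝔸 : Type} [CStarAlgebra 𝔸] [Nontrivial 𝔸]

omit [Nontrivial 𝔸] in
/-- A uniformly bounded family is `Bdd` for every non-positive exponent (the weights `(Lʲη)^{−α}`, `j ≤ k`, are at most `(Lᵏη)^{−α}`).
[cite: Balaban1985RegularSpaces, p.86 (definition after (1.55))] -/
theorem bdd_of_norm_le {ι : Type*} {L k : ℕ} (hL : 1 ≤ L) {η : ℝ} (hη : 0 < η) {α : ℝ} (hα : α ≤ 0) {mem : ℕ → ι → Prop}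
    {F : ι → 𝔸} {c : ℝ} (h : ∀ i, ‖F i‖ ≤ c) : Bdd L k η α mem F := by
  refine bdd_of_forall (c := ((L : ℝ) ^ k * η) ^ (-α) * c) fun j hj i _ => ?_
  have hLr : (1 : ℝ) ≤ L := by exact_mod_cast hL
  have hw : weight L η α j ≤ ((L : ℝ) ^ k * η) ^ (-α) := by
    unfold weight
    exact Real.rpow_le_rpow (scale_pos hL hη j).le (mul_le_mul_of_nonneg_right (pow_le_pow_right₀ hLr hj) hη.le) (by linarith)
  exact mul_le_mul hw (h i) (norm_nonneg _) (Real.rpow_nonneg (scale_pos hL hη k).le _)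

/-- `‖(D^η_{U₀,μ}f)(x)‖ ≤ η⁻¹·2a` for a unitary-valued `U₀` and `‖f‖ ≤ a` (`|R(U)X| ≤ |X|`). [cite: Balaban1985RegularSpaces, (1.1) p.76] -/
theorem norm_covDerivFwd_le_of_bound {η : ℝ} (hη : 0 < η) {U₀ : Site d → Fin d → 𝔸ˣ} (hU₀ : ∀ y κ, U₀ y κ ∈ unitaryUnits 𝔸)
    {f : Site d → 𝔸} {a : ℝ} (hf : ∀ x, ‖f x‖ ≤ a) (μ : Fin d) (x : Site d) : ‖covDerivFwd η U₀ μ f x‖ ≤ η⁻¹ * (2 * a) := by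
  unfold covDerivFwd
  rw [norm_smul, Real.norm_of_nonneg (inv_nonneg.mpr hη.le)]
  refine mul_le_mul_of_nonneg_left ?_ (inv_nonneg.mpr hη.le)
  calc ‖conjR (U₀ x μ) (f (x + e μ)) - f x‖ ≤ ‖conjR (U₀ x μ) (f (x + e μ))‖ + ‖f x‖ := norm_sub_le _ _
    _ ≤ a + a := add_le_add ((norm_conjR_le (unitaryUnits_le_U1 (hU₀ x μ)) _).trans (hf _)) (hf x)
    _ = 2 * a := by ring

/-- `‖(Δ^η_{U₀}f)(x)‖ ≤ d·η⁻¹·2·(η⁻¹·2a)` for a unitary-valued `U₀` and `‖f‖ ≤ a` (`Δ = Σ_μ D*_μ D_μ`). [cite: Balaban1985BackgroundPropagators, (3.23) p.394] -/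
theorem norm_covLap_le_of_bound {η : ℝ} (hη : 0 < η) {U₀ : Site d → Fin d → 𝔸ˣ} (hU₀ : ∀ y κ, U₀ y κ ∈ unitaryUnits 𝔸)
    {f : Site d → 𝔸} {a : ℝ} (hf : ∀ x, ‖f x‖ ≤ a) (x : Site d) :
    ‖covLap η U₀ f x‖ ≤ d * (η⁻¹ * (2 * (η⁻¹ * (2 * a)))) := by
  unfold covLap covDivB
  have hb : ∀ μ : Fin d, ‖covDeriv η U₀ μ (fun z => covDerivFwd η U₀ μ f z) x‖ ≤ η⁻¹ * (2 * (η⁻¹ * (2 * a))) := by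
    intro μ
    refine (norm_covDeriv_le hη (unitaryUnits_le_U1 (hU₀ _ _)) _).trans ?_
    have h1 := norm_covDerivFwd_le_of_bound hη hU₀ hf μ (x - e μ)
    have h2 := norm_covDerivFwd_le_of_bound hη hU₀ hf μ x
    have : 0 ≤ η⁻¹ := inv_nonneg.mpr hη.le
    nlinarith
  calc ‖∑ μ : Fin d, covDeriv η U₀ μ (fun z => covDerivFwd η U₀ μ f z) x‖
      ≤ ∑ μ : Fin d, ‖covDeriv η U₀ μ (fun z => covDerivFwd η U₀ μ f z) x‖ := norm_sum_le _ _
    _ ≤ ∑ _μ : Fin d, η⁻¹ * (2 * (η⁻¹ * (2 * a))) := Finset.sum_le_sum fun μ _ => hb μ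
    _ = d * (η⁻¹ * (2 * (η⁻¹ * (2 * a)))) := by rw [Finset.sum_const, Finset.card_univ, Fintype.card_fin, nsmul_eq_mul]

/-- **(1.36)₂ POINTWISE FROM ITS WEIGHTED SUPREMUM ON THE ALL-TORUS MEMBER**: if `|∇^η_{U₀}A|₍₋₂₎ ≤ c` over the sides touching `Ω_j = ℤᵈ`
(`d ≥ 2`), `A` bounded, `U₀` unitary-valued, then `‖(D^η_{U₀,μ}A_κ)(x)‖ ≤ c·(Lᵏη)^{−2}` at every bond (level `k` weight).
[cite: Balaban1985RegularSpaces, (1.36) p.82, p.86 (definition after (1.55))] -/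
theorem grad_pointwise_of_msup (hd2 : 2 ≤ d) {L k : ℕ} (hL : 1 ≤ L) {η : ℝ} (hη : 0 < η) {Ω : ℕ → Set (Site d)}
    (hΩ : ∀ j, Ω j = Set.univ) {U₀ : Site d → Fin d → 𝔸ˣ} (hU₀ : ∀ y κ, U₀ y κ ∈ unitaryUnits 𝔸) {A : Site d → Fin d → 𝔸}
    {a : ℝ} (hA : ∀ y κ, ‖A y κ‖ ≤ a) {c : ℝ}
    (hm : msup L k η (-(2 : ℝ)) (fun j (t : Fin d × Fin d × Site d) => SideTouches (Ω j) t.2.2 t.2.1)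
      (fun t => covDerivFwd η U₀ t.1 (fun z => A z t.2.1) t.2.2) ≤ c) (μ : Fin d) (x : Site d) (κ : Fin d) :
    ‖covDerivFwd η U₀ μ (fun z => A z κ) x‖ ≤ c * ((L : ℝ) ^ k * η) ^ (-(2 : ℝ)) := by
  have hB : Bdd L k η (-(2 : ℝ)) (fun j (t : Fin d × Fin d × Site d) => SideTouches (Ω j) t.2.2 t.2.1)
      (fun t => covDerivFwd η U₀ t.1 (fun z => A z t.2.1) t.2.2) :=
    bdd_of_norm_le hL hη (by norm_num) fun t => norm_covDerivFwd_le_of_bound hη hU₀ (fun y => hA y t.2.1) t.1 t.2.2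
  have hmem : SideTouches (Ω k) x κ := by rw [hΩ k]; exact sideTouches_univ hd2 x κ
  exact norm_le_of_msup_le hL hη hB hm (j := k) le_rfl (i := (μ, κ, x)) hmem

/-- **(1.39)₂ POINTWISE FROM ITS BOND NORM ON THE ALL-TORUS MEMBER**: `|Δ^η_{U₀}A|₍₋₃₎ ≤ c` ⟹ `‖(Δ^η_{U₀}A_κ)(x)‖ ≤ c·(Lᵏη)^{−3}`.
[cite: Balaban1985RegularSpaces, (1.39) p.83, p.86 (definition after (1.55))] -/
theorem lap_pointwise_of_bondNorm {L k : ℕ} (hL : 1 ≤ L) {η : ℝ} (hη : 0 < η) {Ω : ℕ → Set (Site d)} (hΩ : ∀ j, Ω j = Set.univ)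
    {U₀ : Site d → Fin d → 𝔸ˣ} (hU₀ : ∀ y κ, U₀ y κ ∈ unitaryUnits 𝔸) {A : Site d → Fin d → 𝔸} {a : ℝ}
    (hA : ∀ y κ, ‖A y κ‖ ≤ a) {c : ℝ} (hm : bondNorm L k η (-(3 : ℝ)) Ω (fun x μ => covLap η U₀ (fun z => A z μ) x) ≤ c)
    (x : Site d) (κ : Fin d) : ‖covLap η U₀ (fun z => A z κ) x‖ ≤ c * ((L : ℝ) ^ k * η) ^ (-(3 : ℝ)) := by
  have hB : Bdd L k η (-(3 : ℝ)) (fun j (b : Site d × Fin d) => BondTouches (Ω j) b.1 b.2)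
      (fun b => (fun x μ => covLap η U₀ (fun z => A z μ) x) b.1 b.2) :=
    bdd_of_norm_le hL hη (by norm_num) fun b => norm_covLap_le_of_bound hη hU₀ (fun y => hA y b.2) b.1
  have hmem : BondTouches (Ω k) x κ := Or.inl (by rw [hΩ k]; exact Set.mem_univ x)
  exact norm_le_of_msup_le hL hη hB hm (j := k) le_rfl (i := (x, κ)) hmem

/-- **(1.36)₃ AT THE NEAREST-NEIGHBOUR PAIRS FROM ITS WEIGHTED SUPREMUM ON THE ALL-TORUS MEMBER**: `‖∇^η_{U₀}A‖_{β}-sup ≤ c` (the [4]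
(3.40) quotients over the admissible pairs starting in `Ω_j = ℤᵈ`), `β ≥ 0`, `len ≥ 1` on its support, `‖A‖ ≤ a(Lᵏη)⁻¹`, `U₀`
unitary-valued ⟹ at every admissible pair `(y, y + e_μ)`: `‖R(U₀(y,μ))(D^η_{U₀,μ}A_κ)(y + e_μ) − (D^η_{U₀,μ}A_κ)(y)‖ ≤
c·(Lᵏη)^{−(2+β)}·(η·len e_μ)^β` (`R(U₀(Γ_{y,y+e_μ})) = R(U₀(y,μ))`, `B9Eq340HolderZd.trans_step`).
[cite: Balaban1985RegularSpaces, (1.36) p.82; Balaban1985BackgroundPropagators, (3.40) p.397] -/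
theorem holder_pointwise_of_msup {L k : ℕ} (hL : 1 ≤ L) {η β : ℝ} (hη : 0 < η) (hβ : 0 ≤ β) {len : Site d → ℝ}
    (hlen : ∀ v : Site d, 0 < len v → 1 ≤ len v) {Ω : ℕ → Set (Site d)} (hΩ : ∀ j, Ω j = Set.univ)
    {U₀ : Site d → Fin d → 𝔸ˣ} (hU₀ : ∀ y κ, U₀ y κ ∈ unitaryUnits 𝔸) {A : Site d → Fin d → 𝔸} {a : ℝ}
    (hA : ∀ y κ, ‖A y κ‖ ≤ a * ((L : ℝ) ^ k * η)⁻¹) {c : ℝ}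
    (hm : msup L k η (-(2 + β)) (fun j (q : Fin d × Fin d × (Site d × Site d)) => q.2.2 ∈ AdmPair η len ∧ q.2.2.1 ∈ Ω j)
      (fun q => hquot η β len U₀ (covDerivFwd η U₀ q.1 (fun z => A z q.2.1)) q.2.2) ≤ c)
    (μ : Fin d) (y : Site d) (κ : Fin d) (hp : (y, y + e μ) ∈ AdmPair η len) :
    ‖conjR (U₀ y μ) (covDerivFwd η U₀ μ (fun z => A z κ) (y + e μ)) - covDerivFwd η U₀ μ (fun z => A z κ) y‖
      ≤ c * ((L : ℝ) ^ k * η) ^ (-(2 + β)) * (η * len (e μ)) ^ β := by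
  have h1 : ∀ y κ, U₀ y κ ∈ U1 𝔸 := fun y κ => unitaryUnits_le_U1 (hU₀ y κ)
  have hLpos : 0 < L := hL
  have hB : Bdd L k η (-(2 + β)) (fun j (q : Fin d × Fin d × (Site d × Site d)) => q.2.2 ∈ AdmPair η len ∧ q.2.2.1 ∈ Ω j)
      (fun q => hquot η β len U₀ (covDerivFwd η U₀ q.1 (fun z => A z q.2.1)) q.2.2) := by
    refine bdd_of_forall (c := ((L : ℝ) ^ k * η) ^ (-(-(2 + β))) *
      (2 * ((((L : ℝ) ^ k * η)⁻¹) ^ 2 * gradNorm2 η L k U₀ A) * (η ^ β)⁻¹)) fun j hj q hq => ?_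
    have hLr : (1 : ℝ) ≤ L := by exact_mod_cast hL
    have hw : weight L η (-(2 + β)) j ≤ ((L : ℝ) ^ k * η) ^ (-(-(2 + β))) := by
      unfold weight
      exact Real.rpow_le_rpow (scale_pos hL hη j).le (mul_le_mul_of_nonneg_right (pow_le_pow_right₀ hLr hj) hη.le) (by linarith)
    have hq0 : 0 ≤ hquot η β len U₀ (covDerivFwd η U₀ q.1 (fun z => A z q.2.1)) q.2.2 :=
      B9Eq340HolderZd.hquot_nonneg hη.le β U₀ _ hq.1
    rw [Real.norm_of_nonneg hq0]
    exact mul_le_mul hw (hquot_le_of_141 hη hβ hlen hLpos k h1 hA q.1 q.2.1 hq.1) hq0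
      (Real.rpow_nonneg (scale_pos hL hη k).le _)
  have hmem : (y, y + e μ) ∈ AdmPair η len ∧ (y, y + e μ).1 ∈ Ω k := ⟨hp, by rw [hΩ k]; exact Set.mem_univ y⟩
  have h := norm_le_of_msup_le hL hη hB hm (j := k) le_rfl (i := (μ, κ, (y, y + e μ))) hmem
  have hq0 : 0 ≤ hquot η β len U₀ (covDerivFwd η U₀ μ (fun z => A z κ)) (y, y + e μ) :=
    B9Eq340HolderZd.hquot_nonneg hη.le β U₀ _ hp
  rw [Real.norm_of_nonneg hq0, B9Eq340HolderZd.hquot_def] at h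
  have hv : y + e μ - y = e μ := add_sub_cancel_left y (e μ)
  simp only [hv, trans_step] at h
  have hden : 0 < (η * len (e μ)) ^ β := by
    have hl : 0 < len (e μ) := by have := hp.1; rwa [hv] at this
    exact Real.rpow_pos_of_pos (mul_pos hη hl) β
  rwa [div_le_iff₀ hden] at h

end Readouts

end

end Summit.QuantumFields.YangMills.BalabanUVNodes.N16.Thm4ZdPrintReadouts
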